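import Summits.AtomisticToContinuum.FouriersLaw.Theorems.HonestZwanzigFeshbachIdentitiesCorrelations

/-!
# `HonestZwanzig.FeshbachIdentities`, part 3: the Kolmogorov identity for Laplace-transformed correlations

Support file for item `stmt-AtomisticToContinuum-12697` (`HonestZwanzig.FeshbachIdentities`), clause (iii).
Setting: the pinned anharmonic chain `P = pinnedChain ω₂ lam β γ` (`ω₂ > 0`, `lam ≥ 0`, `β, γ > 0`), `N ≥ 1`,
equal bath temperatures `T > 0`, `μ_T = gibbsMeasure N T`, `P_t = transitionKernel N T T t`, nice observables
(continuous, `O(e^{ϑH})`, `0 < ϑ`, `2ϑ < 1/T`), and the gadgets of route `HonestZwanzig`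
`corr(f,g)(t) = ⟨f, P_t g⟩_{μ_T} - μ_T(f)μ_T(g)`, `lap_s(f,g) = ∫_{(0,∞)} e^{-st} corr(f,g)(t) dt`,
`cov(f,g) = ⟨f,g⟩_{μ_T} - μ_T(f)μ_T(g)`.

* `laplace_primitive_eq` — real analysis: for `ψ ∈ L¹((0,∞))` and `s > 0`,
  `∫_{(0,∞)} e^{-st} (∫₀ᵗ ψ) dt = s⁻¹ ∫_{(0,∞)} e^{-sr} ψ(r) dr` (Fubini on `{0 < r ≤ t}`);
* `pinnedChain_integral_mul_intervalIntegral_act` — Fubini `∫ f (∫₀ʳ P_s ℓ ds) dμ_T = ∫₀ʳ ⟨f, P_s ℓ⟩ ds`;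
* `pinnedChain_integral_eq_zero_of_dynkin` — if `(e, ℓ)` satisfy Dynkin's identity
  `P_r e - e = ∫₀ʳ P_s ℓ ds` pointwise, then `μ_T(ℓ) = 0` (invariance of `μ_T`);
* `pinnedChain_corr_eq_cov_add_primitive` — and `corr(f,e)(t) = cov(f,e) + ∫₀ᵗ corr(f,ℓ)` (`t ≥ 0`);
* `pinnedChain_kolmogorov_lap` — hence **`s·lap_s(f,e) - cov(f,e) = lap_s(f,ℓ)`** for every `s > 0`.

Applied (in the assembly) to the symmetrically split site energies `e = e_x`, `ℓ = L e_x`.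
-/

noncomputable section

open MeasureTheory ProbabilityTheory Filter Topology Set Function
open scoped NNReal ENNReal
open Literature.MathematicalPhysics.KineticTheory.HeatConduction
open Literature.MathematicalPhysics.KineticTheory OscillatorChain
open Summit.AtomisticToContinuum.FouriersLaw.Theorems.SubdiffusiveBondHeat
open Summit.AtomisticToContinuum.FouriersLaw.Theorems.OddSectorIrreversibility

namespace Summit.AtomisticToContinuum.FouriersLaw.Theorems.HonestZwanzig

variable {N : ℕ}

/-! ### Real analysis: the Laplace transform of a primitive -/

/-- **Laplace transform of a primitive**: for `ψ` integrable on `(0,∞)` and `s > 0`,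
`∫_{(0,∞)} e^{-st} (∫₀ᵗ ψ(r) dr) dt = s⁻¹ ∫_{(0,∞)} e^{-sr} ψ(r) dr` (Fubini over `{(t,r) : 0 < r ≤ t}`,
`∫_{[r,∞)} e^{-st} dt = e^{-sr}/s`). [folklore] -/
theorem laplace_primitive_eq {ψ : ℝ → ℝ} (hψ : IntegrableOn ψ (Ioi 0)) {s : ℝ} (hs : 0 < s) :
    ∫ t in Ioi (0 : ℝ), Real.exp (-(s * t)) * (∫ r in (0 : ℝ)..t, ψ r) =
      s⁻¹ * ∫ r in Ioi (0 : ℝ), Real.exp (-(s * r)) * ψ r := by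
  set ν : Measure ℝ := volume.restrict (Ioi (0 : ℝ)) with hν
  -- the integrand on the product
  set G : ℝ → ℝ → ℝ := fun t r => if r ≤ t then Real.exp (-(s * t)) * ψ r else 0 with hG
  have hexpc : Continuous fun t : ℝ => Real.exp (-(s * t)) :=
    Real.continuous_exp.comp (continuous_const.mul continuous_id).neg
  have hexpi : Integrable (fun t : ℝ => Real.exp (-(s * t))) ν := by
    have := exp_neg_integrableOn_Ioi 0 hs
    refine this.congr (Eventually.of_forall fun t => ?_); simp [neg_mul]
  -- integrability of `G` on `ν × ν`
  have hGm : AEStronglyMeasurable (uncurry G) (ν.prod ν) := by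
    have h1 : AEStronglyMeasurable (fun p : ℝ × ℝ => Real.exp (-(s * p.1)) * ψ p.2) (ν.prod ν) :=
      (hexpc.aestronglyMeasurable.comp_fst).mul hψ.aestronglyMeasurable.comp_snd
    have h2 : uncurry G = (setOf fun p : ℝ × ℝ => p.2 ≤ p.1).indicator
        (fun p : ℝ × ℝ => Real.exp (-(s * p.1)) * ψ p.2) := by
      funext p
      simp only [uncurry, hG, Set.indicator_apply, mem_setOf_eq]
    rw [h2]
    exact h1.indicator (measurableSet_le measurable_snd measurable_fst)
  have hGi : Integrable (uncurry G) (ν.prod ν) := by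
    refine (hexpi.mul_prod hψ).norm.mono' hGm (Eventually.of_forall fun p => ?_)
    simp only [uncurry, hG]
    split_ifs
    · exact le_rfl
    · rw [norm_zero]; exact norm_nonneg _
  -- the `t`-sections: `∫ G(t, ·) dν = e^{-st} ∫₀ᵗ ψ` for `t > 0`
  have hL : ∀ t ∈ Ioi (0 : ℝ), ∫ r, G t r ∂ν = Real.exp (-(s * t)) * ∫ r in (0 : ℝ)..t, ψ r := by
    intro t ht
    have e1 : (fun r => G t r) = (Iic t).indicator fun r => Real.exp (-(s * t)) * ψ r := by
      funext r; simp only [hG, Set.indicator_apply, mem_Iic]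
    rw [e1, integral_indicator measurableSet_Iic, hν, Measure.restrict_restrict measurableSet_Iic,
      Iic_inter_Ioi, intervalIntegral.integral_of_le (le_of_lt ht), integral_const_mul]
  -- the `r`-sections: `∫ G(·, r) dν = ψ(r) e^{-sr}/s` for `r > 0`
  have hR : ∀ r ∈ Ioi (0 : ℝ), ∫ t, G t r ∂ν = s⁻¹ * (Real.exp (-(s * r)) * ψ r) := by
    intro r hr
    have e1 : (fun t => G t r) = (Ici r).indicator fun t => ψ r * Real.exp (-(s * t)) := by
      funext t; simp only [hG, Set.indicator_apply, mem_Ici]; split_ifs <;> ring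
    have hsub : Ici r ∩ Ioi (0 : ℝ) = Ici r :=
      inter_eq_left.2 fun t ht => mem_Ioi.2 (lt_of_lt_of_le (mem_Ioi.1 hr) (mem_Ici.1 ht))
    rw [e1, integral_indicator measurableSet_Ici, hν, Measure.restrict_restrict measurableSet_Ici, hsub,
      integral_const_mul, integral_Ici_eq_integral_Ioi]
    have h := integral_exp_mul_Ioi (a := -s) (by linarith) r
    have e2 : (fun t : ℝ => Real.exp (-(s * t))) = fun t => Real.exp (-s * t) := by
      funext t; rw [neg_mul]
    rw [e2, h]
    field_simp
  -- Fubini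
  have hswap := integral_integral_swap hGi
  calc ∫ t in Ioi (0 : ℝ), Real.exp (-(s * t)) * (∫ r in (0 : ℝ)..t, ψ r)
      = ∫ t, (∫ r, G t r ∂ν) ∂ν := (setIntegral_congr_fun measurableSet_Ioi hL).symm
    _ = ∫ r, (∫ t, G t r ∂ν) ∂ν := hswap
    _ = ∫ r in Ioi (0 : ℝ), s⁻¹ * (Real.exp (-(s * r)) * ψ r) := setIntegral_congr_fun measurableSet_Ioi hR
    _ = s⁻¹ * ∫ r in Ioi (0 : ℝ), Real.exp (-(s * r)) * ψ r := integral_const_mul _ _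

section Pinned

variable {ω₂ lam β γ : ℝ} (hω : 0 < ω₂) (hl : 0 ≤ lam) (hβ : 0 < β) (hγ : 0 < γ) (hN : 0 < N)
  {T : ℝ} (hT : 0 < T)
include hω hl hβ hγ hN hT

/-! ### Fubini for `∫ f (∫₀ʳ P_s ℓ) dμ_T` -/

/-- **Fubini**: for nice `f, ℓ` (`0 < ϑ`, `2ϑ < 1/T`) and `r ≥ 0`,
`∫ f(z) (∫₀ʳ P_s ℓ(z) ds) dμ_T(z) = ∫₀ʳ ⟨f, P_s ℓ⟩_{μ_T} ds`; the integrand `(z, s) ↦ f(z) P_s ℓ(z)` is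
jointly measurable and dominated by `const · e^{2ϑH(z)}` (`pinnedChain_abs_act_le`). [folklore] -/
theorem pinnedChain_integral_mul_intervalIntegral_act {ϑ : ℝ} (hϑ0 : 0 < ϑ) (h2ϑ : 2 * ϑ < 1 / T)
    {f ℓ : PhaseSpace N → ℝ} (hf : Continuous f) (hℓ : Continuous ℓ) {Cf Cℓ : ℝ} (hCf : 0 ≤ Cf) (hCℓ : 0 ≤ Cℓ)
    (hfb : ∀ y, |f y| ≤ Cf * Real.exp (ϑ * (pinnedChain ω₂ lam β γ).hamiltonian N y))
    (hℓb : ∀ y, |ℓ y| ≤ Cℓ * Real.exp (ϑ * (pinnedChain ω₂ lam β γ).hamiltonian N y)) {r : ℝ} (hr : 0 ≤ r) :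
    ∫ z, f z * (∫ s in (0 : ℝ)..r, ∫ y, ℓ y ∂((pinnedChain ω₂ lam β γ).transitionKernel N T T s.toNNReal z))
        ∂((pinnedChain ω₂ lam β γ).gibbsMeasure N T) =
      ∫ s in (0 : ℝ)..r, ∫ z, f z * (∫ y, ℓ y ∂((pinnedChain ω₂ lam β γ).transitionKernel N T T s.toNNReal z))
        ∂((pinnedChain ω₂ lam β γ).gibbsMeasure N T) := by
  have hϑ1 : ϑ < 1 / T := by linarith
  set P := pinnedChain ω₂ lam β γ with hP
  set μ := P.gibbsMeasure N T with hμ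
  haveI : IsProbabilityMeasure μ := pinnedChain_isProbabilityMeasure_gibbsMeasure hω hl hβ.le γ N hT
  obtain ⟨K, c, -, hc, hb⟩ := pinnedChain_harris_bound hω hl hβ hγ hN hT hϑ0 hϑ1
  set act : ℝ → PhaseSpace N → ℝ := fun s z => ∫ y, ℓ y ∂(P.transitionKernel N T T s.toNNReal z) with hact
  set m := ∫ y, ℓ y ∂μ with hm
  -- joint measurability and domination of `(z, s) ↦ f z * act s z`
  have hjm : AEStronglyMeasurable (uncurry fun z s => f z * act s z) (μ.prod (volume.restrict (Ioc 0 r))) := by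
    have h1 := (pinnedChain_stronglyMeasurable_act_uncurry hω hl hβ.le hγ.le T T hℓ.measurable).comp_measurable
      (measurable_swap : Measurable fun q : PhaseSpace N × ℝ => q.swap)
    have h2 : StronglyMeasurable fun q : PhaseSpace N × ℝ => f q.1 := (hf.comp continuous_fst).stronglyMeasurable
    exact (h2.mul h1).aestronglyMeasurable
  have hbound : ∀ z s, ‖f z * act s z‖ ≤ (Cf * (|m| + K * Cℓ)) * Real.exp (2 * ϑ * P.hamiltonian N z) * 1 := by
    intro z s
    rw [norm_mul, Real.norm_eq_abs, Real.norm_eq_abs, mul_one]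
    have h1 := hfb z
    have h2 := pinnedChain_abs_act_le hω hl hβ hϑ0 hb hc hℓ hCℓ hℓb z s.toNNReal
    have e2 : Real.exp (2 * ϑ * P.hamiltonian N z) =
        Real.exp (ϑ * P.hamiltonian N z) * Real.exp (ϑ * P.hamiltonian N z) := by
      rw [← Real.exp_add]; ring_nf
    calc |f z| * |act s z| ≤ (Cf * Real.exp (ϑ * P.hamiltonian N z)) *
          ((|m| + K * Cℓ) * Real.exp (ϑ * P.hamiltonian N z)) := mul_le_mul h1 h2 (abs_nonneg _) (by positivity)
      _ = (Cf * (|m| + K * Cℓ)) * Real.exp (2 * ϑ * P.hamiltonian N z) := by rw [e2]; ring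
  have hE2 : Integrable (fun z => Real.exp (2 * ϑ * P.hamiltonian N z)) μ :=
    pinnedChain_integrable_exp_mul_hamiltonian_gibbsMeasure hω hl hβ.le γ N hT h2ϑ
  haveI : IsFiniteMeasure (volume.restrict (Ioc (0 : ℝ) r)) := by
    refine ⟨?_⟩; rw [Measure.restrict_apply_univ]; exact measure_Ioc_lt_top
  have hprod : Integrable (uncurry fun z s => f z * act s z) (μ.prod (volume.restrict (Ioc 0 r))) := by
    refine Integrable.mono' ((hE2.const_mul (Cf * (|m| + K * Cℓ))).mul_prod (integrable_const (1 : ℝ))) hjm ?_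
    exact Eventually.of_forall fun q => hbound q.1 q.2
  rw [intervalIntegral.integral_of_le hr]
  have h1 : ∫ z, f z * (∫ s in (0 : ℝ)..r, act s z) ∂μ = ∫ z, (∫ s in Ioc 0 r, f z * act s z) ∂μ := by
    refine integral_congr_ae (Eventually.of_forall fun z => ?_)
    dsimp only
    rw [intervalIntegral.integral_of_le hr, integral_const_mul]
  rw [h1]
  exact integral_integral_swap hprod

/-! ### Consequences of Dynkin's identity -/

/-- **`μ_T(ℓ) = 0`** when `(e, ℓ)` satisfy Dynkin's identity `P_r e(z) - e(z) = ∫₀ʳ P_s ℓ(z) ds` for the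
equilibrium kernels (`e, ℓ` nice): integrate at `r = 1` against the invariant measure `μ_T`. [folklore] -/
theorem pinnedChain_integral_eq_zero_of_dynkin {ϑ : ℝ} (hϑ0 : 0 < ϑ) (h2ϑ : 2 * ϑ < 1 / T)
    {e ℓ : PhaseSpace N → ℝ} (he : Continuous e) (hℓ : Continuous ℓ) {Ce Cℓ : ℝ} (hCℓ : 0 ≤ Cℓ)
    (heb : ∀ y, |e y| ≤ Ce * Real.exp (ϑ * (pinnedChain ω₂ lam β γ).hamiltonian N y))
    (hℓb : ∀ y, |ℓ y| ≤ Cℓ * Real.exp (ϑ * (pinnedChain ω₂ lam β γ).hamiltonian N y))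
    (hdyn : ∀ (r : ℝ≥0) (z : PhaseSpace N),
      (∫ y, e y ∂((pinnedChain ω₂ lam β γ).transitionKernel N T T r z)) - e z =
        ∫ s in (0 : ℝ)..(r : ℝ), ∫ y, ℓ y ∂((pinnedChain ω₂ lam β γ).transitionKernel N T T s.toNNReal z)) :
    ∫ z, ℓ z ∂((pinnedChain ω₂ lam β γ).gibbsMeasure N T) = 0 := by
  have hϑ1 : ϑ < 1 / T := by linarith
  set P := pinnedChain ω₂ lam β γ with hP
  set μ := P.gibbsMeasure N T with hμ
  haveI : IsProbabilityMeasure μ := pinnedChain_isProbabilityMeasure_gibbsMeasure hω hl hβ.le γ N hT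
  have hei : Integrable e μ := pinnedChain_integrable_nice hω hl hβ hT hϑ1 he heb
  have hℓi : Integrable ℓ μ := pinnedChain_integrable_nice hω hl hβ hT hϑ1 hℓ hℓb
  -- integrate Dynkin at `r = 1`
  have h1 : ∫ z, ((∫ y, e y ∂(P.transitionKernel N T T 1 z)) - e z) ∂μ = 0 := by
    rw [integral_sub _ hei, pinnedChain_integral_transitionKernel_gibbsMeasure hω hl hβ.le hγ.le hN hT 1 hei, sub_self]
    have hinv := pinnedChain_gibbsMeasure_bind_transitionKernel hω hl hβ.le hγ.le hN hT 1
    have h' : (P.transitionKernel N T T 1 ∘ₖ Kernel.const Unit μ) () = μ := by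
      rw [← Measure.comp_eq_comp_const_apply]; exact hinv
    have hei' : Integrable e ((P.transitionKernel N T T 1 ∘ₖ Kernel.const Unit μ) ()) := by rw [h']; exact hei
    have := hei'.integral_comp
    rwa [Kernel.const_apply] at this
  have h2 : ∫ z, ((∫ y, e y ∂(P.transitionKernel N T T 1 z)) - e z) ∂μ =
      ∫ z, (1 : ℝ) * (∫ s in (0 : ℝ)..((1 : ℝ≥0) : ℝ), ∫ y, ℓ y ∂(P.transitionKernel N T T s.toNNReal z)) ∂μ := by
    refine integral_congr_ae (Eventually.of_forall fun z => ?_)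
    dsimp only
    rw [one_mul]
    exact hdyn 1 z
  have hone : ∀ y, |(fun _ : PhaseSpace N => (1 : ℝ)) y| ≤ 1 * Real.exp (ϑ * P.hamiltonian N y) := fun y => by
    simpa using pinnedChain_one_le_exp_mul_hamiltonian hω hl hβ (γ := γ) (N := N) hϑ0.le y
  have h3 := pinnedChain_integral_mul_intervalIntegral_act hω hl hβ hγ hN hT hϑ0 h2ϑ continuous_const hℓ
    zero_le_one hCℓ hone hℓb (r := ((1 : ℝ≥0) : ℝ)) (by simp)
  rw [h1] at h2
  rw [h3] at h2
  simp only [← hP, ← hμ] at h2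
  -- the right-hand side is `∫₀¹ μ_T(ℓ) ds = μ_T(ℓ)`
  have h4 : ∀ s : ℝ, ∫ z, (1 : ℝ) * (∫ y, ℓ y ∂(P.transitionKernel N T T s.toNNReal z)) ∂μ = ∫ z, ℓ z ∂μ := by
    intro s
    simp only [one_mul]
    exact pinnedChain_integral_transitionKernel_gibbsMeasure hω hl hβ.le hγ.le hN hT _ hℓi
  simp only [h4, intervalIntegral.integral_const, NNReal.coe_one, sub_zero, one_smul] at h2
  exact h2.symm

/-- **The truncated correlation is a primitive**: under Dynkin's identity for `(e, ℓ)` (both nice) and for nice `f`,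
`corr(f,e)(t) = cov(f,e) + ∫₀ᵗ corr(f,ℓ)(s) ds` for every `t ≥ 0` (multiply Dynkin by `f`, integrate against `μ_T`,
Fubini, and `μ_T(ℓ) = 0`). [folklore] -/
theorem pinnedChain_corr_eq_cov_add_primitive {ϑ : ℝ} (hϑ0 : 0 < ϑ) (h2ϑ : 2 * ϑ < 1 / T)
    {f e ℓ : PhaseSpace N → ℝ} (hf : Continuous f) (he : Continuous e) (hℓ : Continuous ℓ) {Cf Ce Cℓ : ℝ}
    (hCf : 0 ≤ Cf) (hCℓ : 0 ≤ Cℓ)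
    (hfb : ∀ y, |f y| ≤ Cf * Real.exp (ϑ * (pinnedChain ω₂ lam β γ).hamiltonian N y))
    (heb : ∀ y, |e y| ≤ Ce * Real.exp (ϑ * (pinnedChain ω₂ lam β γ).hamiltonian N y))
    (hℓb : ∀ y, |ℓ y| ≤ Cℓ * Real.exp (ϑ * (pinnedChain ω₂ lam β γ).hamiltonian N y))
    (hdyn : ∀ (r : ℝ≥0) (z : PhaseSpace N),
      (∫ y, e y ∂((pinnedChain ω₂ lam β γ).transitionKernel N T T r z)) - e z =
        ∫ s in (0 : ℝ)..(r : ℝ), ∫ y, ℓ y ∂((pinnedChain ω₂ lam β γ).transitionKernel N T T s.toNNReal z))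
    {t : ℝ} (ht : 0 ≤ t) :
    (∫ z, f z * (∫ y, e y ∂((pinnedChain ω₂ lam β γ).transitionKernel N T T t.toNNReal z))
        ∂((pinnedChain ω₂ lam β γ).gibbsMeasure N T)) -
      (∫ z, f z ∂((pinnedChain ω₂ lam β γ).gibbsMeasure N T)) *
        (∫ z, e z ∂((pinnedChain ω₂ lam β γ).gibbsMeasure N T)) =
    ((∫ z, f z * e z ∂((pinnedChain ω₂ lam β γ).gibbsMeasure N T)) -
      (∫ z, f z ∂((pinnedChain ω₂ lam β γ).gibbsMeasure N T)) *
        (∫ z, e z ∂((pinnedChain ω₂ lam β γ).gibbsMeasure N T))) +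
    ∫ s in (0 : ℝ)..t, ((∫ z, f z * (∫ y, ℓ y ∂((pinnedChain ω₂ lam β γ).transitionKernel N T T s.toNNReal z))
        ∂((pinnedChain ω₂ lam β γ).gibbsMeasure N T)) -
      (∫ z, f z ∂((pinnedChain ω₂ lam β γ).gibbsMeasure N T)) *
        (∫ z, ℓ z ∂((pinnedChain ω₂ lam β γ).gibbsMeasure N T))) := by
  have hϑ1 : ϑ < 1 / T := by linarith
  set P := pinnedChain ω₂ lam β γ with hP
  set μ := P.gibbsMeasure N T with hμ
  rw [pinnedChain_integral_eq_zero_of_dynkin hω hl hβ hγ hN hT hϑ0 h2ϑ he hℓ hCℓ heb hℓb hdyn, mul_zero]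
  simp only [sub_zero]
  rw [← pinnedChain_integral_mul_intervalIntegral_act hω hl hβ hγ hN hT hϑ0 h2ϑ hf hℓ hCf hCℓ hfb hℓb ht]
  -- `∫ f P_t e - ∫ f e = ∫ f (P_t e - e) = ∫ f ∫₀ᵗ P_s ℓ`
  have hI1 := pinnedChain_integrable_mul_act_nice hω hl hβ hγ hN hT hϑ0 h2ϑ hf he hfb heb t.toNNReal
  have hI2 : Integrable (fun z => f z * e z) μ := pinnedChain_integrable_mul_nice hω hl hβ hT h2ϑ hf he hCf hfb heb
  have h1 : (∫ z, f z * (∫ y, e y ∂(P.transitionKernel N T T t.toNNReal z)) ∂μ) - ∫ z, f z * e z ∂μ =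
      ∫ z, f z * (∫ s in (0 : ℝ)..t, ∫ y, ℓ y ∂(P.transitionKernel N T T s.toNNReal z)) ∂μ := by
    rw [← integral_sub hI1 hI2]
    refine integral_congr_ae (Eventually.of_forall fun z => ?_)
    have h := hdyn t.toNNReal z
    rw [Real.coe_toNNReal t ht] at h
    dsimp only
    rw [← mul_sub, h]
  linarith [h1]

/-! ### The Kolmogorov identity in Laplace form -/

/-- **Kolmogorov identity for Laplace-transformed correlations**: for nice `f, e, ℓ` with Dynkin's identity
`P_r e - e = ∫₀ʳ P_s ℓ ds` (pointwise) and every `s > 0`,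
`s · lap_s(f, e) - cov(f, e) = lap_s(f, ℓ)`, where `lap_s(f,g) = ∫_{(0,∞)} e^{-st} corr(f,g)(t) dt`,
`corr(f,g)(t) = ⟨f, P_t g⟩_{μ_T} - μ_T(f)μ_T(g)`, `cov(f,g) = ⟨f,g⟩_{μ_T} - μ_T(f)μ_T(g)`: the correlation is the
primitive `cov + ∫₀ᵗ corr(f,ℓ)` and the Laplace transform of a primitive is `s⁻¹` times that of its derivative.
[cite: CuneoEckmannHairerReyBellet2018, §3 p. 7] -/
theorem pinnedChain_kolmogorov_lap {ϑ : ℝ} (hϑ0 : 0 < ϑ) (h2ϑ : 2 * ϑ < 1 / T)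
    {f e ℓ : PhaseSpace N → ℝ} (hf : Continuous f) (he : Continuous e) (hℓ : Continuous ℓ) {Cf Ce Cℓ : ℝ}
    (hCf : 0 ≤ Cf) (hCe : 0 ≤ Ce) (hCℓ : 0 ≤ Cℓ)
    (hfb : ∀ y, |f y| ≤ Cf * Real.exp (ϑ * (pinnedChain ω₂ lam β γ).hamiltonian N y))
    (heb : ∀ y, |e y| ≤ Ce * Real.exp (ϑ * (pinnedChain ω₂ lam β γ).hamiltonian N y))
    (hℓb : ∀ y, |ℓ y| ≤ Cℓ * Real.exp (ϑ * (pinnedChain ω₂ lam β γ).hamiltonian N y))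
    (hdyn : ∀ (r : ℝ≥0) (z : PhaseSpace N),
      (∫ y, e y ∂((pinnedChain ω₂ lam β γ).transitionKernel N T T r z)) - e z =
        ∫ s in (0 : ℝ)..(r : ℝ), ∫ y, ℓ y ∂((pinnedChain ω₂ lam β γ).transitionKernel N T T s.toNNReal z))
    {s : ℝ} (hs : 0 < s) :
    s * (∫ t in Ioi (0 : ℝ), Real.exp (-(s * t)) *
        ((∫ z, f z * (∫ y, e y ∂((pinnedChain ω₂ lam β γ).transitionKernel N T T t.toNNReal z))
            ∂((pinnedChain ω₂ lam β γ).gibbsMeasure N T)) -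
          (∫ z, f z ∂((pinnedChain ω₂ lam β γ).gibbsMeasure N T)) *
            (∫ z, e z ∂((pinnedChain ω₂ lam β γ).gibbsMeasure N T)))) -
      ((∫ z, f z * e z ∂((pinnedChain ω₂ lam β γ).gibbsMeasure N T)) -
        (∫ z, f z ∂((pinnedChain ω₂ lam β γ).gibbsMeasure N T)) *
          (∫ z, e z ∂((pinnedChain ω₂ lam β γ).gibbsMeasure N T))) =
    ∫ t in Ioi (0 : ℝ), Real.exp (-(s * t)) *
        ((∫ z, f z * (∫ y, ℓ y ∂((pinnedChain ω₂ lam β γ).transitionKernel N T T t.toNNReal z))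
            ∂((pinnedChain ω₂ lam β γ).gibbsMeasure N T)) -
          (∫ z, f z ∂((pinnedChain ω₂ lam β γ).gibbsMeasure N T)) *
            (∫ z, ℓ z ∂((pinnedChain ω₂ lam β γ).gibbsMeasure N T))) := by
  set P := pinnedChain ω₂ lam β γ with hP
  set μ := P.gibbsMeasure N T with hμ
  -- names
  set cov : ℝ := (∫ z, f z * e z ∂μ) - (∫ z, f z ∂μ) * (∫ z, e z ∂μ) with hcov
  set ψ : ℝ → ℝ := fun t => (∫ z, f z * (∫ y, ℓ y ∂(P.transitionKernel N T T t.toNNReal z)) ∂μ) -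
    (∫ z, f z ∂μ) * (∫ z, ℓ z ∂μ) with hψ
  set φ : ℝ → ℝ := fun t => (∫ z, f z * (∫ y, e y ∂(P.transitionKernel N T T t.toNNReal z)) ∂μ) -
    (∫ z, f z ∂μ) * (∫ z, e z ∂μ) with hφ
  have hψi : IntegrableOn ψ (Ioi 0) :=
    pinnedChain_integrableOn_corr_nice hω hl hβ hγ hN hT hϑ0 h2ϑ hf hℓ hCf hCℓ hfb hℓb
  have hprim : ∀ t ∈ Ioi (0 : ℝ), Real.exp (-(s * t)) * φ t =
      cov * Real.exp (-(s * t)) + Real.exp (-(s * t)) * ∫ r in (0 : ℝ)..t, ψ r := by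
    intro t ht
    have h := pinnedChain_corr_eq_cov_add_primitive hω hl hβ hγ hN hT hϑ0 h2ϑ hf he hℓ hCf hCℓ hfb heb hℓb hdyn
      (le_of_lt ht)
    simp only [hφ]
    rw [h]
    ring
  -- integrability of the two pieces of the Laplace integrand
  have hexpi : IntegrableOn (fun t : ℝ => Real.exp (-(s * t))) (Ioi 0) := by
    have := exp_neg_integrableOn_Ioi 0 hs
    refine this.congr (Eventually.of_forall fun t => ?_); simp [neg_mul]
  have hφi : IntegrableOn (fun t : ℝ => Real.exp (-(s * t)) * φ t) (Ioi 0) :=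
    pinnedChain_integrableOn_exp_mul_corr_nice hω hl hβ hγ hN hT hϑ0 h2ϑ hf he hCf hCe hfb heb hs.le
  have hPi : IntegrableOn (fun t : ℝ => Real.exp (-(s * t)) * ∫ r in (0 : ℝ)..t, ψ r) (Ioi 0) := by
    have h : IntegrableOn (fun t : ℝ => Real.exp (-(s * t)) * φ t - cov * Real.exp (-(s * t))) (Ioi 0) :=
      hφi.sub (hexpi.const_mul cov)
    refine h.congr_fun (fun t ht => ?_) measurableSet_Ioi
    dsimp only
    rw [hprim t ht]
    ring
  -- compute the Laplace transform of `φ`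
  have hlapφ : ∫ t in Ioi (0 : ℝ), Real.exp (-(s * t)) * φ t =
      cov * (1 / s) + s⁻¹ * ∫ r in Ioi (0 : ℝ), Real.exp (-(s * r)) * ψ r := by
    rw [setIntegral_congr_fun measurableSet_Ioi hprim, integral_add (hexpi.const_mul cov) hPi, integral_const_mul,
      integral_exp_neg_mul_Ioi hs, laplace_primitive_eq hψi hs]
  show s * (∫ t in Ioi (0 : ℝ), Real.exp (-(s * t)) * φ t) - cov = ∫ t in Ioi (0 : ℝ), Real.exp (-(s * t)) * ψ t
  rw [hlapφ]
  field_simp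
  ring

end Pinned

end Summit.AtomisticToContinuum.FouriersLaw.Theorems.HonestZwanzig

end
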